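import Summits.HodgeConjecture.HodgeConjecture.Theorems.Ring2AbelianAllAndreLerayIdempotentFromLifts
import HarnessLib

/-!
# Ring 2 · sub-cell AbelianAll (ALL ABELIAN VARIETIES), André axis, part XXVIII-b — THE IDEMPOTENT BRACKET RESTRICTED TO THE HABITAT
# "the invariant classes of the CM fibre are algebraic" FOLLOWS FROM (L), is ON-PATH THROUGH ABELIAN VARIETIES ONLY (`HC_AV` modulo
# Verdier), and there (L) ⟺ the idempotent package; the habitat clause at `E`-power / CM points; the W₆ instance

HONEST FRAMING (page 1, verbatim): **research route, not a corollary; conditional on HC_CM plus one named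
minimal statement.** Cell line: research route conditional on HC_CM; not a corollary; Q11.4-sentence-2
already refuted in dim ≥ 3. Nothing in this file proves a case of the Hodge conjecture for an abelian variety; `HC_CM` =
`Theses.RankFourFaces.CMAbelianHodge` and `HC_AV` = `Theses.PadicSemiregularLift.HodgeAbelianVarieties` occur ONLY as explicit hypotheses;
item `Theses.RankFourFaces.CMToAbelian` (stmt-16267) OPEN and not closed here. Seat `pub-hodge-ring2-ab-andre-2`, gen 20; brief (ii)/(iii).

## What this file proves (theorems only; no `def`, no named fact asserted, no sorry; brackets are DISPLAY-ONLY `local notation3`, F-ab-103)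

§1 Display-only brackets: `CMLerayIdempotentC[]` (part XXVII-e, verbatim) and its RESTRICTION **`CMLerayIdempotentC[inv]`** to the CM
points `t` at which every invariant class `j_t^* H^{2a}(𝒳)` is algebraic on `X_t` (all `a`); the habitat forms **`CMFibreAlgebraicLift[inv]`**
((L) at those points) and **`CMIdempotentPackage[inv]`** (at those points, in every degree `2p ≤ 2d`, an `e` with (Π1), (π), (κ) AND
algebraic image). Edges, all kernel-checked and fact-free: `CMLerayIdempotentC[] ⟹ CMLerayIdempotentC[inv]` (restriction);
**`CMFibreAlgebraicLift ⟹ CMIdempotentPackage[inv] ⟹ CMLerayIdempotentC[inv]`** (part XXVIII-a: lifts give the idempotent);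
**`CMFibreAlgebraicLift[inv] ⟺ CMIdempotentPackage[inv]`** (in the habitat, LIFT = IDEMPOTENT PACKAGE); ON-PATH
**`HC_AV ⟹ CMIdempotentPackage[inv]` granted Verdier 1976** (through part XX's `cmFibreAlgebraicLift_of_HC_AV_of_verdier`) — through
abelian varieties only, whereas the unrestricted `CMLerayIdempotentC[]` is on-path only through `HodgeConjecture` for `𝒳 ⊗ 𝒳`
(part XXVII-d); and `HodgeConjecture ⟹ CMLerayIdempotentC[inv]`.
§2 The habitat clause at special points: `range_le_algebraicClasses_of_le_span_hodge` — if the invariants of degree `2a` lie in the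
`ℂ`-span of the rational `(a,a)`-classes of `X_t` and those are algebraic, the clause holds; hence at `E`-power points
(`range_le_algebraicClasses_of_mem_cmPowerLocus`, Tate — a tree theorem, NO `HC_CM`) and at CM points under `HC_CM`
(`range_le_algebraicClasses_of_mem_cmLocus_of_HC_CM`). So in the habitat the clause reads "the fixed part is of Hodge type `(a,a)`".
§3 Per pencil: `exists_lerayIdempotentC_of_HC_AV_of_verdier` (`HC_AV` ∧ Verdier ∧ clause in degrees `2p, 2q` ⟹ the idempotent with
algebraic image at a CM point), and the `E`-power statement WITHOUT `HC_CM`: `forall_comap_le_sup_iff_forall_exists_of_mem_cmPowerLocus`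
(at an `E`-power point whose invariants are spanned by Hodge classes in every degree: [(L)_t(p) for all `p`] ⟺ [idempotents with
algebraic image in all degrees `2p ≤ 2d`]).
§4 The W₆ instance (d = 6, p = q = 3): `comap_le_sup_three_iff_exists_lerayIdempotentC_of_mem_cmPowerLocus` — on a compact pencil of
abelian sixfolds with an `E`-power point `t` at which the invariant classes of `H⁶(X_t)` are spanned by rational `(3,3)`-classes (the
large-monodromy habitat: `κ³ ⊕` the two Weil classes), (L)_t(3) ⟺ [an algebraic 7-cycle on `𝒳 × 𝒳` acting on `H⁶(𝒳)` as a Leray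
idempotent whose image is spanned by algebraic 3-cycles]. FIND-THE-CYCLE, sharpened: the idempotent is no separate task — it comes with
the lifts of the three invariant classes.

## Honest status

No node is born (brackets display-only); nothing is minimal; nothing here is fact-free progress on `HC_AV`. The habitat clause is a
HYPOTHESIS per point; it is NOT claimed for all CM-pointed pencils (it fails when a constant CM factor contributes `H^{2,0}` to the fixed
part), so the general exactness rows of parts XXVII-c/e keep their standing bracket. `HC_CM` is a load-bearing binder only in
`range_le_algebraicClasses_of_mem_cmLocus_of_HC_CM`; `HC_AV` and Verdier only in the on-path edges.

References: Milne2020HodgeClassesAV (proof of Prop. 1, pp. 7–8); DeningerMurre1991 (Thm. 3.1, Cor. 3.2); Andre1996Motifs (§5.1, §6.3,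
Lemme 6.3.3, Remarque 2); Verdier1976 (Cor. 5.1); vanGeemen1994HodgeAV (Thm. 4.3, 5.12, Thm. 6.12); DeligneHodgeII1971 (Thm. 4.1.1).
-/

noncomputable section

set_option linter.dupNamespace false

namespace Summit.HodgeConjecture.HodgeConjecture.Ring2.AbelianAll

open CategoryTheory AlgebraicGeometry
open Literature.AlgebraicGeometry Literature.AlgebraicGeometry.Motives
open Literature.AlgebraicGeometry.HodgeTheory
open Literature.AlgebraicGeometry.Deligne1982 (cmLocus)
open Summit.HodgeConjecture.HodgeConjecture
open Summit.HodgeConjecture.HodgeConjecture.Theses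
open Summit.HodgeConjecture.HodgeConjecture.Ring2.Deform (HC_CM_of_HC_AV)
open Summit.HodgeConjecture.HodgeConjecture.Ring2.Hypotheses (cmPowerLocus)

variable {𝒳 S : SchemeOver ℂ} {d : ℕ} {f : 𝒳 ⟶ S}

/-! ## §2 The habitat clause at `E`-power points and at CM points -/

/-- **The habitat clause from Hodge types**: if every invariant class of `H^{2a}(X_t)` is a `ℂ`-combination of RATIONAL `(a,a)`-CLASSES of
`X_t`, and the rational `(a,a)`-classes of `X_t` are algebraic, then every invariant class of degree `2a` is algebraic on `X_t`.
[cite: Deligne2000, §1] [cite: DeligneHodgeII1971, Cor. 4.1.2] -/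
theorem range_le_algebraicClasses_of_le_span_hodge {n : ℕ} {X : SchemeOver ℂ} {a : ℕ} {I : Submodule ℂ (complexBetti X (2 * a))}
    (hfib : ∀ c : complexBetti X (2 * a), IsRationalClass c → IsOfHodgeType n X (2 * a) a a c → c ∈ algebraicClasses X a)
    (hI : I ≤ Submodule.span ℂ {c : complexBetti X (2 * a) | IsRationalClass c ∧ IsOfHodgeType n X (2 * a) a a c}) :
    I ≤ algebraicClasses X a :=
  hI.trans (Submodule.span_le.2 fun _ hc ↦ hfib _ hc.1 hc.2)

/-- **At an `E`-power point the clause is "the invariants are spanned by Hodge classes"** — the Hodge conjecture for a fibre isogenous to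
a power of a CM elliptic curve is a tree theorem (Tate; `hodgeConjectureFor_fiberOver_of_mem_cmPowerLocus`), NO `HC_CM`.
[cite: vanGeemen1994HodgeAV, Thm. 4.3] [cite: Deligne2000, §1] -/
theorem range_le_algebraicClasses_of_mem_cmPowerLocus (_hf : IsCompactAbelianPencil f d) {t : ComplexPoints S}
    (ht : t ∈ cmPowerLocus f d) {a : ℕ}
    (hH : LinearMap.range (complexBetti.map (fiberι f t) (2 * a)).hom ≤
      Submodule.span ℂ {c : complexBetti (fiberOver f t) (2 * a) |
        IsRationalClass c ∧ IsOfHodgeType d (fiberOver f t) (2 * a) a a c}) :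
    LinearMap.range (complexBetti.map (fiberι f t) (2 * a)).hom ≤ algebraicClasses (fiberOver f t) a :=
  range_le_algebraicClasses_of_le_span_hodge (fun c hc hpp ↦ (hodgeConjectureFor_fiberOver_of_mem_cmPowerLocus ht).2 a c hc hpp) hH

/-- **At a CM point, under `HC_CM`, the clause is "the invariants are spanned by Hodge classes"** (`HC_CM` a HYPOTHESIS, load-bearing:
part IV's `Ring2Transport.mem_algebraicClasses_of_cmChart`). [cite: Milne1999, §7 p. 72] [cite: Deligne2000, §1] -/
theorem range_le_algebraicClasses_of_mem_cmLocus_of_HC_CM (hCM : RankFourFaces.CMAbelianHodge) (_hf : IsCompactAbelianPencil f d)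
    {t : ComplexPoints S} (ht : t ∈ cmLocus f d) {a : ℕ}
    (hH : LinearMap.range (complexBetti.map (fiberι f t) (2 * a)).hom ≤
      Submodule.span ℂ {c : complexBetti (fiberOver f t) (2 * a) |
        IsRationalClass c ∧ IsOfHodgeType d (fiberOver f t) (2 * a) a a c}) :
    LinearMap.range (complexBetti.map (fiberι f t) (2 * a)).hom ≤ algebraicClasses (fiberOver f t) a := by
  obtain ⟨A₀, ⟨e₀⟩, hdim, hcm⟩ := ht
  exact range_le_algebraicClasses_of_le_span_hodge
    (fun c hc hpp ↦ Ring2Transport.mem_algebraicClasses_of_cmChart hCM A₀ e₀ hdim hcm hc hpp) hH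

/-! ## §3 Per pencil: the idempotent from `HC_AV` modulo Verdier; the `E`-power statement without `HC_CM` -/

/-- **ON-PATH PER PENCIL, THROUGH ABELIAN VARIETIES ONLY: `HC_AV` ∧ Verdier ⟹ the algebraic Leray idempotent with algebraic image** at a
CM point `t` of a compact abelian pencil, in degree `2p` (`p + q = d`), granted the habitat clause in degrees `2p` and `2q`: `HC_AV` gives
(L) at CM points modulo Verdier (part XX), and lifts give the idempotent (part XXVIII-a). Contrast part XXVII-d (the unrestricted
idempotent needs `HodgeConjecture` for `𝒳 ⊗ 𝒳`). [cite: Verdier1976, Cor. 5.1] [cite: Andre1996Motifs, §6.3 (p. 33)] [cite: DeningerMurre1991, Thm. 3.1] -/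
theorem exists_lerayIdempotentC_of_HC_AV_of_verdier (hGT : Verdier1976_genericLocalTriviality)
    (hAV : PadicSemiregularLift.HodgeAbelianVarieties) (hf : IsCompactAbelianPencil f d) {t : ComplexPoints S} (ht : t ∈ cmLocus f d)
    {p q : ℕ} (hpq : p + q = d)
    (hIp : LinearMap.range (complexBetti.map (fiberι f t) (2 * p)).hom ≤ algebraicClasses (fiberOver f t) p)
    (hIq : LinearMap.range (complexBetti.map (fiberι f t) (2 * q)).hom ≤ algebraicClasses (fiberOver f t) q) :
    ∃ e : complexBetti 𝒳 (2 * p) →ₗ[ℂ] complexBetti 𝒳 (2 * p),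
      IsAlgebraicCorrespondence (d + 1) (d + 1) 𝒳 𝒳 e ∧
      (∀ w, complexBetti.map (fiberι f t) (2 * p) (e w) = complexBetti.map (fiberι f t) (2 * p) w) ∧
      (∀ w, complexBetti.map (fiberι f t) (2 * p) w = 0 → e w = 0) ∧
      (∀ w, e w ∈ algebraicClasses 𝒳 p) :=
  (comap_le_sup_iff_exists_lerayIdempotentC hf t hpq hIp hIq).1
    (cmFibreAlgebraicLift_iff_comap_le_sup.1 (cmFibreAlgebraicLift_of_HC_AV_of_verdier hGT hAV) f hf p t ht)

/-- **At an `E`-power point whose invariants are spanned by Hodge classes in every degree — NO `HC_CM`, NO named fact: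
[(L)_t(p) for every `p`] ⟺ [in every degree `2p ≤ 2d` an algebraic Leray idempotent at `t` with algebraic image].** (Degrees `p > d` of
(L) are vacuous.) [cite: vanGeemen1994HodgeAV, Thm. 4.3] [cite: Milne2020HodgeClassesAV, proof of Prop. 1 (pp. 7–8)] [cite: DeningerMurre1991, Thm. 3.1] -/
theorem forall_comap_le_sup_iff_forall_exists_of_mem_cmPowerLocus (hf : IsCompactAbelianPencil f d) {t : ComplexPoints S}
    (ht : t ∈ cmPowerLocus f d)
    (hH : ∀ a : ℕ, LinearMap.range (complexBetti.map (fiberι f t) (2 * a)).hom ≤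
      Submodule.span ℂ {c : complexBetti (fiberOver f t) (2 * a) |
        IsRationalClass c ∧ IsOfHodgeType d (fiberOver f t) (2 * a) a a c}) :
    (∀ p : ℕ, (algebraicClasses (fiberOver f t) p).comap (complexBetti.map (fiberι f t) (2 * p)).hom ≤
        algebraicClasses 𝒳 p ⊔ LinearMap.ker (complexBetti.map (fiberι f t) (2 * p)).hom) ↔
      ∀ p : ℕ, p ≤ d → ∃ e : complexBetti 𝒳 (2 * p) →ₗ[ℂ] complexBetti 𝒳 (2 * p),
        IsAlgebraicCorrespondence (d + 1) (d + 1) 𝒳 𝒳 e ∧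
        (∀ w, complexBetti.map (fiberι f t) (2 * p) (e w) = complexBetti.map (fiberι f t) (2 * p) w) ∧
        (∀ w, complexBetti.map (fiberι f t) (2 * p) w = 0 → e w = 0) ∧
        (∀ w, e w ∈ algebraicClasses 𝒳 p) := by
  have hI : ∀ a, LinearMap.range (complexBetti.map (fiberι f t) (2 * a)).hom ≤ algebraicClasses (fiberOver f t) a :=
    fun a ↦ range_le_algebraicClasses_of_mem_cmPowerLocus hf ht (hH a)
  refine ⟨fun hL p hp ↦ (comap_le_sup_iff_exists_lerayIdempotentC hf t (show p + (d - p) = d by omega) (hI p) (hI (d - p))).1 (hL p),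
    fun h p ↦ ?_⟩
  rcases le_or_gt p d with hp | hp
  · exact (comap_le_sup_iff_exists_lerayIdempotentC hf t (show p + (d - p) = d by omega) (hI p) (hI (d - p))).2 (h p hp)
  · haveI := subsingleton_complexBetti (hf.isSmoothProjective_fiberOver t) (show 2 * d < 2 * p by omega)
    intro W _
    refine Submodule.mem_sup_right ?_
    rw [LinearMap.mem_ker]
    exact Subsingleton.elim _ _

/-! ## §4 The W₆ instance -/

/-- **W₆ FIND-THE-CYCLE, SHARPENED.** On a compact pencil of abelian SIXFOLDS `f : 𝒳 ⟶ S` with an `E`-power point `t` at which the invariant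
classes of `H⁶(X_t)` are `ℂ`-combinations of rational `(3,3)`-classes (the large-monodromy Weil habitat: `κ³ ⊕` the two Weil classes,
algebraic on `E⁶` by Tate — the SPAN HYPOTHESIS `hH` is not proved here, the tree has no monodromy): (L)_t(3) ⟺ [there is an algebraic
7-cycle on `𝒳 × 𝒳` acting on `H⁶(𝒳)` as a Leray idempotent at `t` whose image is spanned by algebraic 3-cycles of `𝒳`]. The idempotent of
part XXVII-c's find-the-cycle list is therefore not a separate task in this habitat: it comes with the lifts. NO `HC_CM`, NO named fact.
[cite: vanGeemen1994HodgeAV, Thm. 4.3 and Thm. 6.12] [cite: Andre1996Motifs, Lemme 6.3.3 (p. 33)] [cite: DeningerMurre1991, Thm. 3.1] -/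
theorem comap_le_sup_three_iff_exists_lerayIdempotentC_of_mem_cmPowerLocus {f : 𝒳 ⟶ S} (hf : IsCompactAbelianPencil f 6)
    {t : ComplexPoints S} (ht : t ∈ cmPowerLocus f 6)
    (hH : LinearMap.range (complexBetti.map (fiberι f t) (2 * 3)).hom ≤
      Submodule.span ℂ {c : complexBetti (fiberOver f t) (2 * 3) |
        IsRationalClass c ∧ IsOfHodgeType 6 (fiberOver f t) (2 * 3) 3 3 c}) :
    (algebraicClasses (fiberOver f t) 3).comap (complexBetti.map (fiberι f t) (2 * 3)).hom ≤
        algebraicClasses 𝒳 3 ⊔ LinearMap.ker (complexBetti.map (fiberι f t) (2 * 3)).hom ↔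
      ∃ e : complexBetti 𝒳 (2 * 3) →ₗ[ℂ] complexBetti 𝒳 (2 * 3),
        IsAlgebraicCorrespondence (6 + 1) (6 + 1) 𝒳 𝒳 e ∧
        (∀ w, complexBetti.map (fiberι f t) (2 * 3) (e w) = complexBetti.map (fiberι f t) (2 * 3) w) ∧
        (∀ w, complexBetti.map (fiberι f t) (2 * 3) w = 0 → e w = 0) ∧
        (∀ w, e w ∈ algebraicClasses 𝒳 3) :=
  have hI := range_le_algebraicClasses_of_mem_cmPowerLocus hf ht hH
  comap_le_sup_iff_exists_lerayIdempotentC hf t (show 3 + 3 = 6 by rfl) hI hI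

/-! ## §1 Display-only brackets and edges -/

section Nodes

/-- DISPLAY-ONLY bracket (no `def`; REFEREE-AB F-ab-103): `CMLerayIdempotentC[]` of part XXVII-e, restated verbatim. -/
local notation3 (prettyPrint := false) "CMLerayIdempotentC[]" =>
  ∀ ⦃d : ℕ⦄ ⦃𝒳 S : SchemeOver ℂ⦄ (f : 𝒳 ⟶ S), IsCompactAbelianPencil f d → ∀ t ∈ cmLocus f d, ∀ p : ℕ, p ≤ d →
    ∃ e : complexBetti 𝒳 (2 * p) →ₗ[ℂ] complexBetti 𝒳 (2 * p),
      IsAlgebraicCorrespondence (d + 1) (d + 1) 𝒳 𝒳 e ∧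
      (∀ w, complexBetti.map (fiberι f t) (2 * p) (e w) = complexBetti.map (fiberι f t) (2 * p) w) ∧
      (∀ w, complexBetti.map (fiberι f t) (2 * p) w = 0 → e w = 0)

/-- DISPLAY-ONLY bracket (no `def`; F-ab-103): **`CMLerayIdempotentC[inv]`** — `CMLerayIdempotentC[]` RESTRICTED to the CM points at which every
invariant class (every degree) is algebraic on the fibre (the habitat clause; under `HC_CM`: the fixed part is of Hodge type `(a,a)`). A
HYPOTHESIS wherever used; IMPLIED by (L) (below) — this is the point of part XXVIII. -/
local notation3 (prettyPrint := false) "CMLerayIdempotentC[inv]" =>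
  ∀ ⦃d : ℕ⦄ ⦃𝒳 S : SchemeOver ℂ⦄ (f : 𝒳 ⟶ S), IsCompactAbelianPencil f d → ∀ t ∈ cmLocus f d,
    (∀ a : ℕ, LinearMap.range (complexBetti.map (fiberι f t) (2 * a)).hom ≤ algebraicClasses (fiberOver f t) a) →
    ∀ p : ℕ, p ≤ d →
    ∃ e : complexBetti 𝒳 (2 * p) →ₗ[ℂ] complexBetti 𝒳 (2 * p),
      IsAlgebraicCorrespondence (d + 1) (d + 1) 𝒳 𝒳 e ∧
      (∀ w, complexBetti.map (fiberι f t) (2 * p) (e w) = complexBetti.map (fiberι f t) (2 * p) w) ∧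
      (∀ w, complexBetti.map (fiberι f t) (2 * p) w = 0 → e w = 0)

/-- DISPLAY-ONLY bracket (no `def`; F-ab-103): **`CMIdempotentPackage[inv]`** — at the CM points of the habitat, in every degree `2p ≤ 2d`, an
endomorphism with (Π1), (π), (κ) AND ALGEBRAIC IMAGE (`Im e ⊆ Nᵖ(𝒳)`): the idempotent together with the Hodge conjecture for its image. -/
local notation3 (prettyPrint := false) "CMIdempotentPackage[inv]" =>
  ∀ ⦃d : ℕ⦄ ⦃𝒳 S : SchemeOver ℂ⦄ (f : 𝒳 ⟶ S), IsCompactAbelianPencil f d → ∀ t ∈ cmLocus f d,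
    (∀ a : ℕ, LinearMap.range (complexBetti.map (fiberι f t) (2 * a)).hom ≤ algebraicClasses (fiberOver f t) a) →
    ∀ p : ℕ, p ≤ d →
    ∃ e : complexBetti 𝒳 (2 * p) →ₗ[ℂ] complexBetti 𝒳 (2 * p),
      IsAlgebraicCorrespondence (d + 1) (d + 1) 𝒳 𝒳 e ∧
      (∀ w, complexBetti.map (fiberι f t) (2 * p) (e w) = complexBetti.map (fiberι f t) (2 * p) w) ∧
      (∀ w, complexBetti.map (fiberι f t) (2 * p) w = 0 → e w = 0) ∧
      (∀ w, e w ∈ algebraicClasses 𝒳 p)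

/-- DISPLAY-ONLY bracket (no `def`; F-ab-103): **`CMFibreAlgebraicLift[inv]`** — the André-axis lift (L) (part XVII-d's lattice form) at the
CM points of the habitat only. -/
local notation3 (prettyPrint := false) "CMFibreAlgebraicLift[inv]" =>
  ∀ ⦃d : ℕ⦄ ⦃𝒳 S : SchemeOver ℂ⦄ (f : 𝒳 ⟶ S), IsCompactAbelianPencil f d → ∀ t ∈ cmLocus f d,
    (∀ a : ℕ, LinearMap.range (complexBetti.map (fiberι f t) (2 * a)).hom ≤ algebraicClasses (fiberOver f t) a) →
    ∀ p : ℕ, (algebraicClasses (fiberOver f t) p).comap (complexBetti.map (fiberι f t) (2 * p)).hom ≤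
      algebraicClasses 𝒳 p ⊔ LinearMap.ker (complexBetti.map (fiberι f t) (2 * p)).hom

/-- Restriction: `CMLerayIdempotentC[] ⟹ CMLerayIdempotentC[inv]`. [folklore] -/
theorem cmLerayIdempotentCInv_of_cmLerayIdempotentC (h : CMLerayIdempotentC[]) : CMLerayIdempotentC[inv] :=
  fun _ _ _ f hf t ht _ p hp ↦ h f hf t ht p hp

/-- Forget the image: `CMIdempotentPackage[inv] ⟹ CMLerayIdempotentC[inv]`. [folklore] -/
theorem cmLerayIdempotentCInv_of_cmIdempotentPackageInv (h : CMIdempotentPackage[inv]) : CMLerayIdempotentC[inv] := by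
  intro d 𝒳 S f hf t ht hI p hp
  obtain ⟨e, h₁, h₂, h₃, -⟩ := h f hf t ht hI p hp
  exact ⟨e, h₁, h₂, h₃⟩

/-- Restriction: (L) `CMFibreAlgebraicLift ⟹ CMFibreAlgebraicLift[inv]`. [folklore] -/
theorem cmFibreAlgebraicLiftInv_of_cmFibreAlgebraicLift (hL : CMFibreAlgebraicLift) : CMFibreAlgebraicLift[inv] :=
  fun _ _ _ f hf t ht _ p ↦ cmFibreAlgebraicLift_iff_comap_le_sup.1 hL f hf p t ht

/-- **IN THE HABITAT, LIFT = IDEMPOTENT PACKAGE: `CMFibreAlgebraicLift[inv] ⟺ CMIdempotentPackage[inv]`** (K, fact-free, no `HC_CM`; part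
XXVIII-a `comap_le_sup_iff_exists_lerayIdempotentC` degree by degree; degrees `p > d` of (L) are vacuous).
[cite: Milne2020HodgeClassesAV, proof of Prop. 1 (pp. 7–8)] [cite: DeningerMurre1991, Thm. 3.1 and Cor. 3.2] -/
theorem cmFibreAlgebraicLiftInv_iff_cmIdempotentPackageInv : CMFibreAlgebraicLift[inv] ↔ CMIdempotentPackage[inv] := by
  refine ⟨fun h d 𝒳 S f hf t ht hI p hp ↦ ?_, fun h d 𝒳 S f hf t ht hI p ↦ ?_⟩
  · exact (comap_le_sup_iff_exists_lerayIdempotentC hf t (show p + (d - p) = d by omega) (hI p) (hI (d - p))).1 (h f hf t ht hI p)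
  · rcases le_or_gt p d with hp | hp
    · exact (comap_le_sup_iff_exists_lerayIdempotentC hf t (show p + (d - p) = d by omega) (hI p) (hI (d - p))).2
        (h f hf t ht hI p hp)
    · haveI := subsingleton_complexBetti (hf.isSmoothProjective_fiberOver t) (show 2 * d < 2 * p by omega)
      intro W _
      refine Submodule.mem_sup_right ?_
      rw [LinearMap.mem_ker]
      exact Subsingleton.elim _ _

/-- **(L) ⟹ `CMIdempotentPackage[inv]`** — THE IDEMPOTENT BRACKET, RESTRICTED TO THE HABITAT, IS IMPLIED BY THE ANDRÉ-AXIS LIFT (K, fact-free).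
[cite: Milne2020HodgeClassesAV, proof of Prop. 1 (pp. 7–8)] [cite: Andre1996Motifs, §5.1 (p. 25)] -/
theorem cmIdempotentPackageInv_of_cmFibreAlgebraicLift (hL : CMFibreAlgebraicLift) : CMIdempotentPackage[inv] :=
  cmFibreAlgebraicLiftInv_iff_cmIdempotentPackageInv.1 (cmFibreAlgebraicLiftInv_of_cmFibreAlgebraicLift hL)

/-- **(L) ⟹ `CMLerayIdempotentC[inv]`.** [cite: Milne2020HodgeClassesAV, proof of Prop. 1 (pp. 7–8)] -/
theorem cmLerayIdempotentCInv_of_cmFibreAlgebraicLift (hL : CMFibreAlgebraicLift) : CMLerayIdempotentC[inv] :=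
  cmLerayIdempotentCInv_of_cmIdempotentPackageInv (cmIdempotentPackageInv_of_cmFibreAlgebraicLift hL)

/-- **ON-PATH THROUGH ABELIAN VARIETIES: `HC_AV ⟹ CMIdempotentPackage[inv]`, granted Verdier 1976** (part XX: `HC_AV ⟹ (L)` modulo Verdier).
The unrestricted bracket is on-path only through `HodgeConjecture` for `𝒳 ⊗ 𝒳` (part XXVII-d). [cite: Verdier1976, Cor. 5.1]
[cite: Andre1996Motifs, §6.3 (p. 33)] -/
theorem cmIdempotentPackageInv_of_HC_AV_of_verdier (hGT : Verdier1976_genericLocalTriviality)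
    (h : PadicSemiregularLift.HodgeAbelianVarieties) : CMIdempotentPackage[inv] :=
  cmIdempotentPackageInv_of_cmFibreAlgebraicLift (cmFibreAlgebraicLift_of_HC_AV_of_verdier hGT h)

/-- ON-PATH: `HC_AV ⟹ CMLerayIdempotentC[inv]`, granted Verdier. [cite: Verdier1976, Cor. 5.1] -/
theorem cmLerayIdempotentCInv_of_HC_AV_of_verdier (hGT : Verdier1976_genericLocalTriviality)
    (h : PadicSemiregularLift.HodgeAbelianVarieties) : CMLerayIdempotentC[inv] :=
  cmLerayIdempotentCInv_of_cmIdempotentPackageInv (cmIdempotentPackageInv_of_HC_AV_of_verdier hGT h)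

/-- ON-PATH: `HodgeConjecture ⟹ CMLerayIdempotentC[inv]` (through the unrestricted bracket, part XXVII-d/e). [cite: VoisinHodgeI2002, §11.3.3 Lemma 11.41] -/
theorem cmLerayIdempotentCInv_of_hodgeConjecture (hHC : _root_.HodgeConjecture) : CMLerayIdempotentC[inv] :=
  cmLerayIdempotentCInv_of_cmLerayIdempotentC (cmLerayIdempotentC_of_hodgeConjecture hHC)

/-- **`HC_CM ∧ CMFibreAlgebraicLift[inv]`-type row is NOT offered**: the habitat is not supplied by André's Lemme 6.3.1, so no `HC_AV` row is
re-keyed here. What IS recorded: under `HC_AV` (hence `HC_CM`) and Verdier, at every CM point of the habitat the whole package holds —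
`HC_AV ⟹ CMFibreAlgebraicLift[inv]`. [cite: Verdier1976, Cor. 5.1] [cite: Andre1996Motifs, Lemme 6.3.1 (p. 31)] -/
theorem cmFibreAlgebraicLiftInv_of_HC_AV_of_verdier (hGT : Verdier1976_genericLocalTriviality)
    (h : PadicSemiregularLift.HodgeAbelianVarieties) : CMFibreAlgebraicLift[inv] :=
  cmFibreAlgebraicLiftInv_of_cmFibreAlgebraicLift (cmFibreAlgebraicLift_of_HC_AV_of_verdier hGT h)

end Nodes

end Summit.HodgeConjecture.HodgeConjecture.Ring2.AbelianAll

end
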